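import Summits.CriticalPhenomena.PercolationContinuityZ3.Theorems.PercNearOneGluingNoHeavyQuantChemicalRadiusCritical
import Summits.CriticalPhenomena.PercolationContinuityZ3.Theorems.PercNearOneGluingNoHeavyLowerTailCSHTheoremOne
import HarnessLib

/-!
# THE EVENT `{Rad_int(C(0)) ≥ r}` IS LOCAL (read off `Λ_r`), `p ↦ P_p(Rad_int ≥ r)` IS A POLYNOMIAL, and the p205010 reading:
# `P_{p_c}(Rad_int(C(0)) ≥ r) → θ(p_c) = 0` as `r → ∞` in EVERY `d ≥ 2`, while `≥ 1/(e(r+3))` — the critical chemical one-arm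
# exponent lies in `[0, 1]` wherever it exists — quant lane, seat p4 gen 38, file 6

builds on p205010 (kernel theorem, internal audit signed; external expert review pending) — USED in §3 ONLY
(`percolationContinuity_allDimensions`: `θ_{ℤ^d}(p_c) = 0`, every `d ≥ 2`; the lane's status sentence: "θ(p_c) = 0 on ℤ^d, all d ≥ 2 —
kernel-verified (Lean 4/Mathlib, standard axioms); internal adversarial audit SIGNED 2026-08-20 04:29Z; external expert review pending").
Seat `prim-quant-p4`, `--supports stmt-CriticalPhenomena-4575`; pure proofs, no definitions (`local notation3` only).

* §1 **`ChemRad.far_subset_far_box`**, **`ChemRad.far_box_eq_far`** (`N ≥ r`): `far K_N 0 r = far ℤ^d 0 r` — a lattice geodesic's first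
  `r` steps stay in `Λ_r`, and its `r`-th vertex is at box-chemical distance exactly `r`.  So `{Rad_int(C(0)) ≥ r}` is determined by
  the edges of `Λ_r` (`ChemRad.determinedBy_far_zd`; Kozma–Nachmias' locality of intrinsic balls), and file 2's box exhaustion
  (`tendsto_real_far_box`) is in fact eventually constant.
* §2 **`ChemRad.continuous_real_far`** — `p ↦ P_p(Rad_int(C(0)) ≥ r)` is continuous on `[0,1]` (a cylinder polynomial), every `d`, `r`;
  with file 1 it is differentiable on `(0,1)` with `d/dp P_p ≤ (r/p)P_p`.
* §3 **`ChemRad.tendsto_real_far_criticalProbI`** (p205010) — every `d ≥ 2`: `P_{p_c}(Rad_int(C(0)) ≥ r) → 0` as `r → ∞`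
  (`⋂_r {Rad_int ≥ r} ⊆ {|C(0)| = ∞}`, continuity from above, `θ(p_c) = 0`); together with file 3's floor `≥ 1/(e(r+3))` and
  file 5's `Σ_r = ∞`: **the critical chemical one-arm probability tends to zero, but no faster than `1/r`, in every dimension** —
  `ChemRad.chemical_oneArm_sandwich`.

HONEST STATUS.  §1–§2 folklore (locality) made explicit; §3 is a READING of p205010 (θ(p_c) = 0) — qualitative (`→ 0`), the only rate
being the LOWER one.  NO rate, NO exponent for `d = 3`; (T1)/(T2) and the lane's honest sentence UNCHANGED.

References: G. Kozma, A. Nachmias, Invent. Math. 178 (2009) §1.3, §3.2 (locality of `B(0,r;G)`) [KozmaNachmias2009]; T. Hutchcroft,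
PLMS 125 (2022) Lemma 2.1, Prop. 4.2 [Hutchcroft2022SlightlySupercritical]; G. Kozma, N. Nitzan (2024) Thm 6 / this tree's p205010
[KozmaNitzan2024].
-/

noncomputable section

namespace Summit.CriticalPhenomena.PercolationContinuityZ3.Theorems

open MeasureTheory Set Filter Topology Literature.Probability.Percolation Literature.Probability.LatticeModels
open Literature.Probability.Percolation.Chemical
open scoped Classical

namespace ChemRad

variable {d : ℕ}

/-- `K_N`: the step graph of `ℤ^d` whose edges are the lattice edges with both endpoints in `Λ_N` (as in files 2, 4). -/
local notation3 "KB[" N "]" =>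
  SimpleGraph.fromEdgeSet (↑(edgesIn (zdGraph d) (box d N)) : Set (Sym2 (Site d)))

/-! ### §1. Locality: `far K_N 0 r = far ℤ^d 0 r` for `N ≥ r` -/

/-- **`far ℤ^d 0 r ⊆ far K_N 0 r` for `N ≥ r`**: the `r`-th vertex of an open lattice geodesic from `0` to a site at distance `≥ r`
is joined to `0` inside `Λ_r ⊆ Λ_N` by the first `r` steps, and its `K_N`-distance is `≥` its lattice distance `= r`.
[cite: KozmaNachmias2009, §3.2 (edges needed to calculate B(0,j;G))] -/
theorem far_subset_far_box {r N : ℕ} (hN : r ≤ N) :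
    far (zdGraph d) 0 r ⊆ far (KB[N] : SimpleGraph (Site d)) 0 r := by
  rintro ω ⟨z, hz, hrz⟩
  obtain ⟨w, hw⟩ := hz.exists_walk_length_eq_dist
  have hrw : r ≤ w.length := by rw [hw]; exact hrz
  -- the `r`-th vertex `u` of the geodesic and the initial segment `w.take r`
  have hdist : (openGraph ω ⊓ zdGraph d).dist 0 (w.getVert r) = r := dist_getVert_of_length_eq_dist w hw hrw
  have hlen : (w.take r).length = r := by rw [SimpleGraph.Walk.take_length]; exact min_eq_left hrw
  have hreach : (openGraph ω ⊓ KB[N]).Reachable 0 (w.getVert r) :=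
    ⟨(w.take r).transfer _ (edges_mem_boxGraph (w.take r) (by rw [hlen]; exact hN))⟩
  refine ⟨w.getVert r, hreach, ?_⟩
  calc r = (openGraph ω ⊓ zdGraph d).dist 0 (w.getVert r) := hdist.symm
    _ ≤ _ := dist_anti (inf_le_inf_left _ (boxGraph_le N)) hreach

/-- **LOCALITY: `far K_N 0 r = far ℤ^d 0 r` for every `N ≥ r`** — the event `{Rad_int(C(0)) ≥ r}` is read off the edges of `Λ_r`.
[cite: KozmaNachmias2009, §3.2 (edges needed to calculate B(0,j;G))] -/
theorem far_box_eq_far {r N : ℕ} (hN : r ≤ N) :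
    far (KB[N] : SimpleGraph (Site d)) 0 r = far (zdGraph d) 0 r :=
  Set.Subset.antisymm (far_box_subset_far hN) (far_subset_far_box hN)

/-- `{Rad_int(C(0)) ≥ r}` is determined by the (finitely many) lattice edges inside `Λ_r`. [folklore] -/
theorem determinedBy_far_zd (r : ℕ) :
    DeterminedBy (far (zdGraph d) (0 : Site d) r) (↑(edgesIn (zdGraph d) (box d r)) : Set (Sym2 (Site d))) := by
  rw [← far_box_eq_far le_rfl]
  refine (determinedBy_far _ 0 r).mono ?_
  rw [SimpleGraph.edgeSet_fromEdgeSet]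
  exact Set.sdiff_subset

/-! ### §2. `p ↦ P_p(Rad_int(C(0)) ≥ r)` is continuous on `[0,1]` -/

/-- A cylinder polynomial is continuous. [folklore] -/
theorem continuous_cylPoly {ι : Type*} (u : Set ι) (K : Finset ι) (B : Set (Set ι)) :
    Continuous (Russo.cylPoly u K B) := by
  unfold Russo.cylPoly
  refine continuous_finsetSum _ fun S _ => ?_
  split_ifs
  · exact continuous_finsetProd _ fun i _ => continuous_iff_continuousAt.2 fun q => (Russo.hasDerivAt_weight u _ i q).continuousAt
  · exact continuous_const

/-- **`p ↦ P_p(Rad_int(C(0)) ≥ r)` is continuous on `[0,1]`** (a polynomial in `p`, by locality), every `d`, `r`. [folklore] -/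
theorem continuous_real_far (r : ℕ) :
    Continuous fun q : unitInterval => (bondPercolation (zdGraph d) q).real (far (zdGraph d) (0 : Site d) r) := by
  have h : (fun q : unitInterval => (bondPercolation (zdGraph d) q).real (far (zdGraph d) (0 : Site d) r)) =
      fun q : unitInterval => Russo.cylPoly (zdGraph d).edgeSet (edgesIn (zdGraph d) (box d r)) (far (zdGraph d) (0 : Site d) r) q := by
    funext q
    exact Russo.measureReal_eq_cylPoly (determinedBy_far_zd r) (zdGraph d).edgeSet q
  rw [h]
  exact (continuous_cylPoly _ _ _).comp continuous_subtype_val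

/-! ### §3. The p205010 reading: `P_{p_c}(Rad_int(C(0)) ≥ r) → 0`, no faster than `1/r`, in every `d ≥ 2` -/

/-- `⋂_r {Rad_int(C(0)) ≥ r} ⊆ {|C(0)| = ∞}`: a cluster with sites at every chemical distance is infinite. [folklore] -/
theorem iInter_far_subset_percolatesAt :
    (⋂ r : ℕ, far (zdGraph d) (0 : Site d) r) ⊆ percolatesAt (0 : Site d) := by
  intro ω hω
  rw [Set.mem_iInter] at hω
  refine percolatesVia_subset_percolatesAt (zdGraph d) 0 ?_
  -- the constrained cluster contains a site at distance `≥ r` for every `r`, hence is infinite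
  intro hfin
  set C : Set (Site d) := openClusterIn (zdGraph d) ω 0 with hC
  obtain ⟨R, hR⟩ : ∃ R : ℕ, ∀ y ∈ C, (openGraph ω ⊓ zdGraph d).dist 0 y < R := by
    obtain ⟨R, hR⟩ := (hfin.image fun y => (openGraph ω ⊓ zdGraph d).dist 0 y).bddAbove
    exact ⟨R + 1, fun y hy => Nat.lt_succ_of_le (hR ⟨y, hy, rfl⟩)⟩
  obtain ⟨z, hz, hRz⟩ := hω R
  exact absurd (hR z (mem_openClusterIn_iff.2 hz)) (not_lt.2 hRz)

/-- **p205010 READING, every `d ≥ 2`: `P_{p_c}(Rad_int(C(0)) ≥ r) → 0` as `r → ∞`** (continuity from above onto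
`⋂_r {Rad_int ≥ r} ⊆ {|C(0)| = ∞}`, which is `P_{p_c}`-null by `θ(p_c) = 0` — the tree's `percolationContinuity_allDimensions`, p205010).
builds on p205010 (kernel theorem, internal audit signed; external expert review pending).
[cite: KozmaNitzan2024, Thm. 6 with Conj. 3 (p. 15)] -/
theorem tendsto_real_far_criticalProbI (hd : 2 ≤ d) :
    Tendsto (fun r : ℕ => (bondPercolation (zdGraph d) (criticalProbI d)).real (far (zdGraph d) (0 : Site d) r)) atTop (𝓝 0) := by
  set μ := bondPercolation (zdGraph d) (criticalProbI d) with hμ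
  have hanti : Antitone fun r : ℕ => far (zdGraph d) (0 : Site d) r := far_antitone (zdGraph d) 0
  have hmeas : ∀ r : ℕ, NullMeasurableSet (far (zdGraph d) (0 : Site d) r) μ :=
    fun r => (measurableSet_far (zdGraph d) 0 r).nullMeasurableSet
  have hlim := tendsto_measure_iInter_atTop (μ := μ) hmeas hanti ⟨0, measure_ne_top _ _⟩
  have hzero : μ (⋂ r : ℕ, far (zdGraph d) (0 : Site d) r) = 0 := by
    have hθ : μ.real (percolatesAt (0 : Site d)) = 0 := CSH.percolationContinuity_allDimensions d hd
    have hθ' : μ (percolatesAt (0 : Site d)) = 0 := by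
      rwa [measureReal_def, ENNReal.toReal_eq_zero_iff, or_iff_left (measure_ne_top _ _)] at hθ
    exact measure_mono_null iInter_far_subset_percolatesAt hθ'
  rw [hzero] at hlim
  have h := (ENNReal.tendsto_toReal ENNReal.zero_ne_top).comp hlim
  rw [ENNReal.toReal_zero] at h
  exact h

/-- **THE CRITICAL CHEMICAL ONE-ARM SANDWICH, every `d ≥ 2`: `1/(e(r+3)) ≤ P_{p_c}(Rad_int(C(0)) ≥ r) → 0`** — the probability that
the critical cluster of the origin reaches chemical distance `r` tends to zero (θ(p_c) = 0, p205010) but no faster than `1/r`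
(hypothesis-free floor of file 3); so the critical chemical one-arm exponent, wherever it exists, lies in `[0, 1]` (mean field: `1`).
builds on p205010 (kernel theorem, internal audit signed; external expert review pending).
[cite: Hutchcroft2022SlightlySupercritical, Prop. 4.2] [cite: KozmaNitzan2024, Thm. 6 with Conj. 3 (p. 15)] -/
theorem chemical_oneArm_sandwich (hd : 2 ≤ d) :
    (∀ r : ℕ, 1 / (Real.exp 1 * (r + 3)) ≤ (bondPercolation (zdGraph d) (criticalProbI d)).real (far (zdGraph d) (0 : Site d) r)) ∧
      Tendsto (fun r : ℕ => (bondPercolation (zdGraph d) (criticalProbI d)).real (far (zdGraph d) (0 : Site d) r)) atTop (𝓝 0) :=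
  ⟨real_far_criticalProbI_ge hd, tendsto_real_far_criticalProbI hd⟩

end ChemRad

end Summit.CriticalPhenomena.PercolationContinuityZ3.Theorems

end
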